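import Summits.QuantumFields.BalabanUV.Beta.GAN24.HkKingOneStepSup
import Summits.QuantumFields.BalabanUV.Beta.GAN24.SoftColumnTwoLevel
import Summits.QuantumFields.BalabanUV.Beta.GAN24.SoftColumnSupLetter
import Summits.QuantumFields.BalabanUV.T4Continuum.Support.BalabanDeltaKIdentification

/-!
# `BalabanUV.Beta.GAN24.HkStaircaseOneStep` — binder row G-an2-4 ∕ (CONV-C), route R7: the `H_k` one-step law of `HkKingOneStep(Sup)` READ IN
# ROAD P2's ∕ leaf-04's VOCABULARY (`stairV`, `Hk`, `colOp`, `MsoftV`, `covOp`) — the right-hand sides of leaf-04 g50's located equivalence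
# `SoftColumnTwoLevel.colOp_succ_sub_eq_Hk` and of p2 g30's `SoftVectorMinimiserTwoLevel.MsoftV_succ_sub` ARE SMALL, every torus, every `a > 0`

NOT IN PRINT; OUR PROOF ATTEMPT (prover part P3 of row G-an2-4, fibre∕strip («Woodbury») lineage, gen 27; CRUX TEAM (2), ruling «YM
REDIRECT TOWARDS THE SUMMIT», 2026-08-21).  HONEST DEPENDENCY (cell records, verbatim): «continuum YM on T⁴ ⇐ BetaPertH ∧ nine spine
estimates (0/9 proved); BetaPertH ⇐ (D1) ∧ (D4) ∧ CAP+tail; G-an2-4 gates asym, D1 and NE2/3/4.»  HONEST FRAMING (cell contract, verbatim):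
«discharging `BetaPertH` makes Bałaban's UV stability UNCONDITIONAL — a real constructive-QFT result; it is NOT the continuum limit and NOT
the Clay problem.»  ABSOLUTE RULE: nothing printed is a hypothesis; no `def … : Prop`, no sorry; [folklore] assembly over TREE objects BY NAME.

## Why this file

Road P2's «componentwise staircase» `stairV N R M` IS King's block-parent map (`StaircaseAveragingDefect.stairV_mulVec`: `((J⊗1)u)(x′,μ) = u(par x′, μ)`),
so the `H_k` one-step law of `HkKingOneStepSup` (entries ∕ row sums ∕ `sup → sup`, every torus, `d`-only constants) is LITERALLY a statement about
`Hk (R·N) − stairV·Hk N` — the operator leaf-04 g50 (`SoftColumnTwoLevel`, INTENT 3 (iii)), p2 g30 (INBOX l.8642 ∕ `SoftVectorMinimiserTwoLevel` Part 12)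
and the refuter (PRICING v3.10 check #55) located as «the `H_k` constituent of (CONV-C) — crux-sized ∕ S–M».  This file writes the law in their names.
 * §1 `stairV_mul_apply` (`(J·A)(X′, i) = A(parT X′, i)`); **`sum_norm_Hk_sub_stairV_le`**: `Σ_i ‖(Hk (R·N) − stairV·Hk N)(X′, i)‖ ≤ KH1s(d)∕N`;
   **`norm_Hk_sub_stairV_mulVec_le`**: `‖((Hk (R·N) − stairV·Hk N)·B)(X′)‖ ≤ KH1s(d)∕N·‖B‖_∞` — every `N, R ≥ 1`, torus, `a > 0`.
 * §2 **`norm_colOp_sub_stairV_apply_le`**: `‖(colOp (R·N) − stairV·colOp N)(X′, q)‖ ≤ KH d·‖covOp (R·N) − covOp N‖ + a⁻¹·KH1s(d)∕N` (leaf-04's exact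
   `colOp_succ_sub_eq_Hk` + leaf-03's `sum_norm_HkOp_le` + `norm_entry_le_opNorm` + (1.100) `norm_QGQ_apply_le` + §1), general `N, R`; `MsoftV = a•colOp`
   likewise (`norm_MsoftV_sub_stairV_apply_le`).
 * §3 THE TOWER `N = L^k`, `R = L`: `‖covOp (L·n_k) − covOp n_k‖ ≤ CQB(d+1, a)·L^{−k}` (`covOp = QGQ = covBlev`, NE2-P1 `opNorm_covBlev_succ_sub_le`), hence
   **`norm_MsoftV_sub_stairV_apply_le_lev`**: `‖(MsoftV (L·n_k) − stairV·MsoftV n_k)(X′, q)‖ ≤ δHc′(d,a,L,k) := (a·KH d·CQB(d+1,a) + KH1s d)·(L⁻¹)^k` — p2's Part 12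
   residual and leaf-04's `Π′D` (by their `one_sub_projR_mul_colOp_succ_sub`, `Π′D = D − (1−Π′)D`) are small at rate `L⁻¹` in sup-entry currency,
   every torus, every `a > 0`.

HONEST SCOPE.  [folklore] bookkeeping BY NAME over `HkKingOneStepSup`, leaf-04's `SoftColumnTwoLevel`, leaf-03's `SoftColumnSupLetter`, NE2-P1's tower;
`U = 1`; sup-ENTRY currency (not kernel decay — that is `HkKingOneStep.norm_HkOp_king_sub_le` for the `H` factor); rate `θ = L⁻¹`; constants crude;
NOT (CONV-C) as a whole, NEVER «G-an2-4 closed», NOT NE2, NOT D1, NOT BetaPertH, NOT continuum, NOT Clay.  Locators (text only):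
[Balaban1984PropagatorsI] (1.63) p. 28, (1.71) p. 29, (1.100)–(1.103) p. 35; [King1986] p. 664, (2.10) p. 653.  Provenance: prover-b2b-balaban-gan24-p3-g27-0
(unit `b2b-balaban-gan24-p3`, gen 27), 2026-08-21.
-/

noncomputable section

open scoped BigOperators ComplexConjugate Matrix Matrix.Norms.L2Operator
open Finset

namespace Summit.QuantumFields.BalabanUV.Beta.GAN24.HkStaircaseOneStep

open Literature.MathematicalPhysics.QuantumFieldTheory.Balaban1983to89
open Literature.MathematicalPhysics.QuantumFieldTheory.Balaban1983to89.B5Prop11Plancherel (Tor fine)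
open Literature.MathematicalPhysics.QuantumFieldTheory.Balaban1983to89.B5G183RateUnitTower (lev lev_neZero)
open Literature.MathematicalPhysics.QuantumFieldTheory.Balaban1983to89.B5Hk163Torus (HkOp)
open Literature.MathematicalPhysics.QuantumFieldTheory.Balaban1983to89.B5Hk163Form166 (HkOp_eq_Hk)
open Literature.MathematicalPhysics.QuantumFieldTheory.Balaban1983to89.Beta.FluctuationProjection (Hk QGQ)
open Summit.QuantumFields.BalabanUV.T4Continuum
open Summit.QuantumFields.BalabanUV.T4Continuum.BalabanAveragedTowerUnit (one_le_lev' cast_lev' norm_entry_le_opNorm)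
open Summit.QuantumFields.BalabanUV.T4Continuum.BalabanAveragedCoerciveTower (covBlev opNorm_covBlev_succ_sub_le)
open Summit.QuantumFields.BalabanUV.T4Continuum.BalabanLineAverage (CQB CQB_nonneg)
open Summit.QuantumFields.BalabanUV.T4Continuum.BlockPairingGeometry (parT)
open Summit.QuantumFields.BalabanUV.T4Continuum.BalabanAveragedTowerModes (par)
open Summit.QuantumFields.BalabanUV.T4Continuum.BalabanDeltaKIdentification (covB_eq_QGQ)
open Summit.QuantumFields.BalabanUV.Beta.GAN24.StaircaseAveragingDefect (stairV stairV_mulVec)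
open Summit.QuantumFields.BalabanUV.Beta.GAN24.AveragedPropagatorTwoLevel (covOp)
open Summit.QuantumFields.BalabanUV.Beta.GAN24.AveragedPropagatorInverseUniform (covOp_eq_QGQ)
open Summit.QuantumFields.BalabanUV.Beta.GAN24.SoftVectorMinimiserTwoLevel (MsoftV)
open Summit.QuantumFields.BalabanUV.Beta.GAN24.SoftColumnTwoLevel (colOp MsoftV_eq_smul_colOp colOp_succ_sub_eq_Hk)
open Summit.QuantumFields.BalabanUV.Beta.GAN24.SoftColumnSupLetter (KH KH_nonneg norm_QGQ_apply_le sum_norm_HkOp_le)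
open Summit.QuantumFields.BalabanUV.Beta.GAN24.HkKingOneStepSup (KH1s KH1s_nonneg sum_norm_HkOp_par_sub_le norm_HkOp_par_mulVec_sub_le)

variable {d : ℕ}

/-! ## §1 `Hk (R·N) − stairV·Hk N` — the hard minimiser against the componentwise staircase = King's parent -/

section TwoLevel

variable (N R : ℕ) [NeZero N] [NeZero R] (M : Fin (d + 1) → ℕ) [hM : ∀ μ, NeZero (M μ)] (a : ℝ)

omit [NeZero R] in
/-- `(stairV·A)(X′, i) = A(parT X′, i)` — the staircase row of `X′` is the delta at its parent. [folklore] -/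
theorem stairV_mul_apply {κ : Type*} (A : Matrix (Tor (fine N M) × Fin (d + 1)) κ ℂ) (X' : Tor (fine (R * N) M) × Fin (d + 1)) (i : κ) :
    (stairV N R M * A) X' i = A (parT N R M X') i := by
  have h : (stairV N R M * A) X' i = (stairV N R M *ᵥ fun j => A j i) X' := by
    simp only [Matrix.mul_apply, Matrix.mulVec, dotProduct]
  rw [h, stairV_mulVec]
  rfl

/-- the entries of `Hk (R·N) − stairV·Hk N` are those of b05's `HkOp (R·N) − HkOp N ∘ par`. [folklore] -/
theorem Hk_sub_stairV_apply (ha : 0 < a) (X' : Tor (fine (R * N) M) × Fin (d + 1)) (i : Tor M × Fin (d + 1)) :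
    (Hk (R * N) (Nat.one_le_iff_ne_zero.mpr (NeZero.ne (R * N))) M a ha
        - stairV N R M * Hk N (Nat.one_le_iff_ne_zero.mpr (NeZero.ne N)) M a ha) X' i
      = HkOp (R * N) M X' i - HkOp N M (par N R M X'.1, X'.2) i := by
  rw [Matrix.sub_apply, stairV_mul_apply, ← HkOp_eq_Hk, ← HkOp_eq_Hk]
  rfl

/-- **ROW SUMS**: `Σ_i ‖(Hk (R·N) − stairV·Hk N)(X′, i)‖ ≤ KH1s(d)∕N` for every fine bond `X′` of level `RN` — every torus, `d`-only constant
(`HkKingOneStepSup.sum_norm_HkOp_par_sub_le`). [folklore] -/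
theorem sum_norm_Hk_sub_stairV_le (ha : 0 < a) (X' : Tor (fine (R * N) M) × Fin (d + 1)) :
    ∑ i : Tor M × Fin (d + 1), ‖(Hk (R * N) (Nat.one_le_iff_ne_zero.mpr (NeZero.ne (R * N))) M a ha
        - stairV N R M * Hk N (Nat.one_le_iff_ne_zero.mpr (NeZero.ne N)) M a ha) X' i‖ ≤ KH1s d / N := by
  simp_rw [Hk_sub_stairV_apply]
  exact sum_norm_HkOp_par_sub_le M X'

/-- **THE `sup → sup` LAW IN ROAD P2's NAMES**: for `‖B‖_∞ ≤ b`, `‖((Hk (R·N) − stairV·Hk N)·B)(X′)‖ ≤ KH1s(d)∕N · b` — the one-step rate of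
Bałaban's hard minimiser against the componentwise staircase on bounded unit-lattice fields (leaf-04 INTENT 3 (iii)'s right-hand side), every
torus, every `a > 0`, NO log. [cite: King1986, Prop. 3.8 (3.71) p.664 (scalar template)] [folklore] -/
theorem norm_Hk_sub_stairV_mulVec_le (ha : 0 < a) (B : Tor M × Fin (d + 1) → ℂ) {b : ℝ} (hb : ∀ i, ‖B i‖ ≤ b)
    (X' : Tor (fine (R * N) M) × Fin (d + 1)) :
    ‖((Hk (R * N) (Nat.one_le_iff_ne_zero.mpr (NeZero.ne (R * N))) M a ha
        - stairV N R M * Hk N (Nat.one_le_iff_ne_zero.mpr (NeZero.ne N)) M a ha) *ᵥ B) X'‖ ≤ KH1s d / N * b := by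
  have e : ((Hk (R * N) (Nat.one_le_iff_ne_zero.mpr (NeZero.ne (R * N))) M a ha
        - stairV N R M * Hk N (Nat.one_le_iff_ne_zero.mpr (NeZero.ne N)) M a ha) *ᵥ B) X'
      = (HkOp (R * N) M *ᵥ B) X' - (HkOp N M *ᵥ B) (par N R M X'.1, X'.2) := by
    rw [Matrix.sub_mulVec, Pi.sub_apply, ← Matrix.mulVec_mulVec, stairV_mulVec, ← HkOp_eq_Hk, ← HkOp_eq_Hk]
  rw [e]
  exact norm_HkOp_par_mulVec_sub_le M B hb X'

/-! ## §2 The column map `colOp = 𝒢·Q*` and `MsoftV = a•colOp` against the staircase, general `N, R` -/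

/-- **leaf-04's located equivalence, right-hand side bounded**: for every fine bond `X′` and coarse bond `q`,
`‖(colOp (R·N) − stairV·colOp N)(X′, q)‖ ≤ KH d·‖covOp (R·N) − covOp N‖ + a⁻¹·KH1s(d)∕N` — by `SoftColumnTwoLevel.colOp_succ_sub_eq_Hk`, leaf-03's row
sums of `H_k`, `norm_entry_le_opNorm`, §1, and (1.100) `|(Q𝒢_aQ*)_{q′q}| ≤ a⁻¹`. [cite: Balaban1984PropagatorsI, (1.100)–(1.103) p.35] [folklore] -/
theorem norm_colOp_sub_stairV_apply_le (ha : 0 < a) (X' : Tor (fine (R * N) M) × Fin (d + 1)) (q : Tor M × Fin (d + 1)) :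
    ‖(colOp (R * N) M a - stairV N R M * colOp N M a) X' q‖
      ≤ KH d * ‖covOp (R * N) M a - covOp N M a‖ + a⁻¹ * (KH1s d / N) := by
  have hN : 1 ≤ N := Nat.one_le_iff_ne_zero.mpr (NeZero.ne N)
  have hRN : 1 ≤ R * N := Nat.one_le_iff_ne_zero.mpr (NeZero.ne (R * N))
  rw [colOp_succ_sub_eq_Hk N R M a ha hN hRN, Matrix.add_apply]
  -- first term: `(H′·(c′ − c))(X′, q)`
  have h1 : ‖(Hk (R * N) hRN M a ha * (covOp (R * N) M a - covOp N M a)) X' q‖ ≤ KH d * ‖covOp (R * N) M a - covOp N M a‖ := by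
    rw [Matrix.mul_apply, ← HkOp_eq_Hk]
    calc ‖∑ j, HkOp (R * N) M X' j * (covOp (R * N) M a - covOp N M a) j q‖
        ≤ ∑ j, ‖HkOp (R * N) M X' j * (covOp (R * N) M a - covOp N M a) j q‖ := norm_sum_le _ _
      _ ≤ ∑ j, ‖HkOp (R * N) M X' j‖ * ‖covOp (R * N) M a - covOp N M a‖ :=
          Finset.sum_le_sum fun j _ => by
            rw [norm_mul]; exact mul_le_mul_of_nonneg_left (norm_entry_le_opNorm _ j q) (norm_nonneg _)
      _ = (∑ j, ‖HkOp (R * N) M X' j‖) * ‖covOp (R * N) M a - covOp N M a‖ := by rw [Finset.sum_mul]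
      _ ≤ KH d * ‖covOp (R * N) M a - covOp N M a‖ := mul_le_mul_of_nonneg_right (sum_norm_HkOp_le M (R * N) X') (norm_nonneg _)
  -- second term: `((H′ − J·H)·c)(X′, q)`
  have hc : ∀ j, ‖covOp N M a j q‖ ≤ a⁻¹ := fun j => by
    rw [covOp_eq_QGQ N M a hN ha]; exact norm_QGQ_apply_le M a ha N hN j q
  have h2 : ‖((Hk (R * N) hRN M a ha - stairV N R M * Hk N hN M a ha) * covOp N M a) X' q‖ ≤ a⁻¹ * (KH1s d / N) := by
    rw [Matrix.mul_apply]
    calc ‖∑ j, (Hk (R * N) hRN M a ha - stairV N R M * Hk N hN M a ha) X' j * covOp N M a j q‖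
        ≤ ∑ j, ‖(Hk (R * N) hRN M a ha - stairV N R M * Hk N hN M a ha) X' j * covOp N M a j q‖ := norm_sum_le _ _
      _ ≤ ∑ j, ‖(Hk (R * N) hRN M a ha - stairV N R M * Hk N hN M a ha) X' j‖ * a⁻¹ :=
          Finset.sum_le_sum fun j _ => by rw [norm_mul]; exact mul_le_mul_of_nonneg_left (hc j) (norm_nonneg _)
      _ = (∑ j, ‖(Hk (R * N) hRN M a ha - stairV N R M * Hk N hN M a ha) X' j‖) * a⁻¹ := by rw [Finset.sum_mul]
      _ ≤ KH1s d / N * a⁻¹ := mul_le_mul_of_nonneg_right (sum_norm_Hk_sub_stairV_le N R M a ha X') (inv_nonneg.mpr ha.le)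
      _ = a⁻¹ * (KH1s d / N) := mul_comm _ _
  exact (norm_add_le _ _).trans (add_le_add h1 h2)

/-- **p2's Part 12 residual, bounded**: `‖(MsoftV (R·N) − stairV·MsoftV N)(X′, q)‖ ≤ a·KH d·‖covOp (R·N) − covOp N‖ + KH1s(d)∕N` (`MsoftV = a•colOp`).
[cite: Balaban1984PropagatorsI, (1.71) p.29] [folklore] -/
theorem norm_MsoftV_sub_stairV_apply_le (ha : 0 < a) (X' : Tor (fine (R * N) M) × Fin (d + 1)) (q : Tor M × Fin (d + 1)) :
    ‖(MsoftV (R * N) M a - stairV N R M * MsoftV N M a) X' q‖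
      ≤ a * (KH d * ‖covOp (R * N) M a - covOp N M a‖) + KH1s d / N := by
  have e : MsoftV (R * N) M a - stairV N R M * MsoftV N M a = (a : ℂ) • (colOp (R * N) M a - stairV N R M * colOp N M a) := by
    rw [MsoftV_eq_smul_colOp, MsoftV_eq_smul_colOp, Matrix.mul_smul, smul_sub]
  rw [e, Matrix.smul_apply, smul_eq_mul, norm_mul, Complex.norm_real, Real.norm_of_nonneg ha.le]
  calc a * ‖(colOp (R * N) M a - stairV N R M * colOp N M a) X' q‖
      ≤ a * (KH d * ‖covOp (R * N) M a - covOp N M a‖ + a⁻¹ * (KH1s d / N)) :=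
        mul_le_mul_of_nonneg_left (norm_colOp_sub_stairV_apply_le N R M a ha X' q) ha.le
    _ = a * (KH d * ‖covOp (R * N) M a - covOp N M a‖) + KH1s d / N := by field_simp

end TwoLevel

/-! ## §3 Along the tower `n_k = L^k`: the averaged propagator's tower law closes the bound at rate `L⁻¹` -/

section Tower

variable (L : ℕ) [NeZero L] (M : Fin (d + 1) → ℕ) [hM : ∀ μ, NeZero (M μ)] (a : ℝ)

/-- road P2's `covOp n_k M a` IS NE2-P1's `covBlev k` on b05's carrier (`covOp_eq_QGQ`, `covB_eq_QGQ`). [folklore] -/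
theorem covOp_eq_covBlev (ha : 0 < a) (k : ℕ) : covOp (lev L k) M a = covBlev L M a ha k := by
  rw [covOp_eq_QGQ (lev L k) M a (one_le_lev' L k) ha, covBlev, covB_eq_QGQ]

/-- the one-step law of the averaged propagator along the tower, in road P2's names: `‖covOp (L·n_k) − covOp n_k‖ ≤ CQB(d+1,a)·(L⁻¹)^k`
(NE2-P1's `opNorm_covBlev_succ_sub_le` BY NAME). [folklore] -/
theorem opNorm_covOp_succ_sub_le_lev (ha : 0 < a) (k : ℕ) :
    ‖covOp (L * lev L k) M a - covOp (lev L k) M a‖ ≤ CQB (d + 1) a * ((L : ℝ)⁻¹) ^ k := by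
  have h := opNorm_covBlev_succ_sub_le L M a ha k
  rw [← covOp_eq_covBlev L M a ha (k + 1), ← covOp_eq_covBlev L M a ha k] at h
  exact h

/-- the rate constant `(a·KH d·CQB(d+1,a) + KH1s d)·(L⁻¹)^k` (equal to `SoftColumnConsistency.δHc`). OURS. [folklore] -/
def δHc' (d : ℕ) (a : ℝ) (L : ℕ) (k : ℕ) : ℝ := (a * KH d * CQB (d + 1) a + KH1s d) * ((L : ℝ)⁻¹) ^ k

/-- **p2's PART 12 RESIDUAL ∕ leaf-04's `Π′D` ALONG THE TOWER, CLOSED**: for every `a > 0`, `L ≥ 1`, torus, level `k`, fine bond `X′` of level `k+1`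
and coarse bond `q`, `‖(MsoftV (L·n_k) − stairV·MsoftV n_k)(X′, q)‖ ≤ (a·KH d·CQB(d+1,a) + KH1s d)·(L⁻¹)^k`. [folklore] -/
theorem norm_MsoftV_sub_stairV_apply_le_lev (ha : 0 < a) (k : ℕ) (X' : Tor (fine (L * lev L k) M) × Fin (d + 1))
    (q : Tor M × Fin (d + 1)) :
    ‖(MsoftV (L * lev L k) M a - stairV (lev L k) L M * MsoftV (lev L k) M a) X' q‖ ≤ δHc' d a L k := by
  have hL0 : (0 : ℝ) < L := by exact_mod_cast Nat.pos_of_ne_zero (NeZero.ne L)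
  have h := norm_MsoftV_sub_stairV_apply_le (lev L k) L M a ha X' q
  have hc := opNorm_covOp_succ_sub_le_lev L M a ha k
  have hK := KH_nonneg d
  refine h.trans ?_
  rw [δHc', cast_lev', div_eq_mul_inv, ← inv_pow]
  have : a * (KH d * ‖covOp (L * lev L k) M a - covOp (lev L k) M a‖) ≤ a * (KH d * (CQB (d + 1) a * ((L : ℝ)⁻¹) ^ k)) :=
    mul_le_mul_of_nonneg_left (mul_le_mul_of_nonneg_left hc hK) ha.le
  calc a * (KH d * ‖covOp (L * lev L k) M a - covOp (lev L k) M a‖) + KH1s d * ((L : ℝ)⁻¹) ^ k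
      ≤ a * (KH d * (CQB (d + 1) a * ((L : ℝ)⁻¹) ^ k)) + KH1s d * ((L : ℝ)⁻¹) ^ k := add_le_add this le_rfl
    _ = (a * KH d * CQB (d + 1) a + KH1s d) * ((L : ℝ)⁻¹) ^ k := by ring

/-- the same for the column map `colOp = 𝒢Q*` (leaf-04's `D := colOp′ − J·colOp`): `‖D(X′, q)‖ ≤ (KH d·CQB(d+1,a) + a⁻¹·KH1s d)·(L⁻¹)^k`. [folklore] -/
theorem norm_colOp_sub_stairV_apply_le_lev (ha : 0 < a) (k : ℕ) (X' : Tor (fine (L * lev L k) M) × Fin (d + 1))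
    (q : Tor M × Fin (d + 1)) :
    ‖(colOp (L * lev L k) M a - stairV (lev L k) L M * colOp (lev L k) M a) X' q‖
      ≤ (KH d * CQB (d + 1) a + a⁻¹ * KH1s d) * ((L : ℝ)⁻¹) ^ k := by
  have h := norm_colOp_sub_stairV_apply_le (lev L k) L M a ha X' q
  have hc := opNorm_covOp_succ_sub_le_lev L M a ha k
  have hK := KH_nonneg d
  refine h.trans ?_
  rw [cast_lev', div_eq_mul_inv, ← inv_pow]
  calc KH d * ‖covOp (L * lev L k) M a - covOp (lev L k) M a‖ + a⁻¹ * (KH1s d * ((L : ℝ)⁻¹) ^ k)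
      ≤ KH d * (CQB (d + 1) a * ((L : ℝ)⁻¹) ^ k) + a⁻¹ * (KH1s d * ((L : ℝ)⁻¹) ^ k) :=
        add_le_add (mul_le_mul_of_nonneg_left hc hK) le_rfl
    _ = (KH d * CQB (d + 1) a + a⁻¹ * KH1s d) * ((L : ℝ)⁻¹) ^ k := by ring

end Tower

end Summit.QuantumFields.BalabanUV.Beta.GAN24.HkStaircaseOneStep

end
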